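import Mathlib
import HarnessLib
import Literature.Analysis.FluidPDE.KochTataruKernel
import Literature.Analysis.FluidPDE.OseenDuhamelLowFrequency

/-!
# Route `QuarterLogPincer`, crux `TypeIQuantSubcubicExp` (stmt-NavierStokesRegularity-24077), line `quiet_collar` — towards QP2
# `stub_cutPair`, module M1 (Oseen commutator), part a: THE HALF-MOMENT OF THE OSEEN MAJORANT

The Oseen commutator of the cut reference, `χ(x)·B(ṽ,ṽ)(t,x) − B(χṽ,χṽ)(t,x) = ∫₀ᵗ∫ (χ(x) − χ(y)²)·K(t−τ,x−y)(ṽ,ṽ)(τ,y)dydτ`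
(`…QuietCollarCutReference.mildDefect_cutRef_eq`), carries the weight `|χ(x) − χ(y)| ≤ min(1, C₁|x−y|/L) ≤ (C₁/L)^{1/2}|x−y|^{1/2}`
(the collar cut-off is `C₁/L`-Lipschitz, `…QuietCollarHeatCommutator.exists_abs_radialCutoff_sub_le`).  The first moment of the
Oseen majorant `k(σ,z) = C(σ + |z|²)⁻²` is infinite (`|z|·|z|⁻⁴` is not integrable at infinity), the HALF moment is not:
`∫ k(σ,z)|z|^{1/2}dz = m_{1/2}·σ^{−1/4}` (parabolic scaling), and `∫₀ᵗ (t−τ)^{−1/4}dτ < ∞` — which is what makes the commutator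
`O((C₁/L)^{1/2})`, polynomially small in the collar width and UNIFORM IN THE RADIUS.  This file: the weighted scaling identity
`integral_add_norm_sq_rpow_neg_two_mul_sqrt` on `ℝ³`, its integrability, and the majorant form
`integral_oseenMajorant_mul_sqrt_norm`.  r-INDEPENDENT groundwork for QP2 (typed audit, pub-ns-dss bus 2026-08-29T01:10Z).
HONEST FRAME: a kernel integral; nothing here bears on 24077, W7 or Navier–Stokes regularity (OPEN).  Helper of the pub-ns-dss
typer (g36), `--supports 24077`.
-/

noncomputable section

set_option linter.dupNamespace false

namespace Summit.NavierStokesRegularity.NavierStokesRegularity.Cruxes.TypeIQuantSubcubicExp.QuietCollar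

open MeasureTheory Set Function Filter Real Metric
open scoped ENNReal NNReal Topology
open Literature.Analysis Literature.Analysis.FluidPDE

/-- `finrank ℝ ℝ³ = 3` as a real number inside the Oseen exponent: `((3:ℕ) + 1)/2 = 2`. [folklore] -/
theorem oseen_exponent_fin_three : (((Module.finrank ℝ (EuclideanSpace ℝ (Fin 3)) : ℝ) + 1) / 2) = 2 := by
  rw [finrank_euclideanSpace_fin]; norm_num

/-- The half-weighted unit profile `(1 + |w|²)⁻²|w|^{1/2}` is integrable on `ℝ³` (dominated by `(1 + |w|²)^{−7/4}`,
`7/2 > 3`). [folklore] -/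
theorem integrable_one_add_norm_sq_rpow_neg_two_mul_sqrt :
    Integrable fun w : EuclideanSpace ℝ (Fin 3) => (1 + ‖w‖ ^ 2) ^ (-(2 : ℝ)) * ‖w‖ ^ (1 / 2 : ℝ) := by
  have h74 : (Module.finrank ℝ (EuclideanSpace ℝ (Fin 3)) : ℝ) < 2 * (7 / 4 : ℝ) := by
    rw [finrank_euclideanSpace_fin]; norm_num
  refine (integrable_one_add_norm_sq_rpow_neg h74).mono' ?_ (Eventually.of_forall fun w => ?_)
  · exact (((continuous_const.add (continuous_norm.pow 2)).rpow_const fun w =>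
      Or.inl (by positivity : (1 + ‖w‖ ^ 2 : ℝ) ≠ 0)).mul
      (continuous_norm.rpow_const fun _ => Or.inr (by norm_num))).aestronglyMeasurable
  · have h1 : 0 < 1 + ‖w‖ ^ 2 := by positivity
    rw [Real.norm_of_nonneg (by positivity)]
    have hw : ‖w‖ ^ (1 / 2 : ℝ) ≤ (1 + ‖w‖ ^ 2) ^ (1 / 4 : ℝ) := by
      have e1 : ‖w‖ ^ (1 / 2 : ℝ) = (‖w‖ ^ 2) ^ (1 / 4 : ℝ) := by
        rw [← Real.rpow_natCast, ← Real.rpow_mul (norm_nonneg _)]; norm_num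
      rw [e1]
      exact Real.rpow_le_rpow (by positivity) (by linarith) (by norm_num)
    calc (1 + ‖w‖ ^ 2) ^ (-(2 : ℝ)) * ‖w‖ ^ (1 / 2 : ℝ) ≤ (1 + ‖w‖ ^ 2) ^ (-(2 : ℝ)) * (1 + ‖w‖ ^ 2) ^ (1 / 4 : ℝ) :=
          mul_le_mul_of_nonneg_left hw (Real.rpow_nonneg h1.le _)
      _ = (1 + ‖w‖ ^ 2) ^ (-(7 / 4 : ℝ)) := by
          rw [← Real.rpow_add h1]; norm_num

/-- **PARABOLIC SCALING OF THE HALF MOMENT**: `∫ (τ + |z|²)⁻²|z|^{1/2}dz = τ^{−1/4}·∫ (1 + |w|²)⁻²|w|^{1/2}dw` on `ℝ³`, `τ > 0`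
(substitute `z = √τ·w`: `dz = τ^{3/2}dw`, `(τ + |z|²)⁻² = τ⁻²(1+|w|²)⁻²`, `|z|^{1/2} = τ^{1/4}|w|^{1/2}`). [folklore] -/
theorem integral_add_norm_sq_rpow_neg_two_mul_sqrt {τ : ℝ} (hτ : 0 < τ) :
    ∫ z : EuclideanSpace ℝ (Fin 3), (τ + ‖z‖ ^ 2) ^ (-(2 : ℝ)) * ‖z‖ ^ (1 / 2 : ℝ) =
      τ ^ (-(1 / 4 : ℝ)) * ∫ w : EuclideanSpace ℝ (Fin 3), (1 + ‖w‖ ^ 2) ^ (-(2 : ℝ)) * ‖w‖ ^ (1 / 2 : ℝ) := by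
  set R : ℝ := Real.sqrt τ with hR
  have hR0 : 0 < R := Real.sqrt_pos.2 hτ
  have hR2 : R ^ 2 = τ := Real.sq_sqrt hτ.le
  have hRτ : R = τ ^ (1 / 2 : ℝ) := by rw [hR, Real.sqrt_eq_rpow]
  -- `f (R • w) = τ^{-2} τ^{1/4} (1 + ‖w‖²)^{-2} ‖w‖^{1/2}`
  have hcomp : ∀ w : EuclideanSpace ℝ (Fin 3), (τ + ‖R • w‖ ^ 2) ^ (-(2 : ℝ)) * ‖R • w‖ ^ (1 / 2 : ℝ) =
      τ ^ (-(2 : ℝ)) * τ ^ (1 / 4 : ℝ) * ((1 + ‖w‖ ^ 2) ^ (-(2 : ℝ)) * ‖w‖ ^ (1 / 2 : ℝ)) := by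
    intro w
    rw [norm_smul, Real.norm_of_nonneg hR0.le, mul_pow, hR2, show τ + τ * ‖w‖ ^ 2 = τ * (1 + ‖w‖ ^ 2) by ring,
      Real.mul_rpow hτ.le (by positivity), Real.mul_rpow hR0.le (norm_nonneg _), hRτ, ← Real.rpow_mul hτ.le]
    norm_num
    ring
  have hscale := Measure.integral_comp_smul (volume : Measure (EuclideanSpace ℝ (Fin 3)))
    (fun z : EuclideanSpace ℝ (Fin 3) => (τ + ‖z‖ ^ 2) ^ (-(2 : ℝ)) * ‖z‖ ^ (1 / 2 : ℝ)) R
  simp only [hcomp, integral_const_mul, finrank_euclideanSpace_fin] at hscale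
  have hRd : |(R ^ 3)⁻¹| = τ ^ (-(3 / 2 : ℝ)) := by
    rw [abs_of_pos (by positivity), ← Real.rpow_natCast, hRτ, ← Real.rpow_mul hτ.le, ← Real.rpow_neg hτ.le]
    norm_num
  rw [hRd, smul_eq_mul] at hscale
  have hτd : τ ^ (-(3 / 2 : ℝ)) ≠ 0 := (Real.rpow_pos_of_pos hτ _).ne'
  have key : ∫ z : EuclideanSpace ℝ (Fin 3), (τ + ‖z‖ ^ 2) ^ (-(2 : ℝ)) * ‖z‖ ^ (1 / 2 : ℝ) =
      (τ ^ (-(3 / 2 : ℝ)))⁻¹ * (τ ^ (-(2 : ℝ)) * τ ^ (1 / 4 : ℝ) *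
        ∫ w : EuclideanSpace ℝ (Fin 3), (1 + ‖w‖ ^ 2) ^ (-(2 : ℝ)) * ‖w‖ ^ (1 / 2 : ℝ)) := by
    rw [hscale, ← mul_assoc, inv_mul_cancel₀ hτd, one_mul]
  rw [key, ← Real.rpow_neg_one, ← Real.rpow_mul hτ.le, ← Real.rpow_add hτ, ← mul_assoc, ← Real.rpow_add hτ]
  norm_num

/-- **THE HALF MOMENT OF THE OSEEN MAJORANT**: `∫ k(σ,z)·|z|^{1/2} dz = C_K·m_{1/2}·σ^{−1/4}` on `ℝ³` for `σ > 0`, where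
`k = oseenMajorant` (`‖K(σ,z)[a,b]‖ ≤ k(σ,z)‖a‖‖b‖`, `norm_oseenKernel_le_oseenMajorant`), `C_K = oseenKernelBoundConst` and
`m_{1/2} = ∫(1+|w|²)⁻²|w|^{1/2}dw`. [folklore] -/
theorem integral_oseenMajorant_mul_sqrt_norm {σ : ℝ} (hσ : 0 < σ) :
    ∫ z : EuclideanSpace ℝ (Fin 3), oseenMajorant (EuclideanSpace ℝ (Fin 3)) σ z * ‖z‖ ^ (1 / 2 : ℝ) =
      oseenKernelBoundConst (EuclideanSpace ℝ (Fin 3)) *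
        (∫ w : EuclideanSpace ℝ (Fin 3), (1 + ‖w‖ ^ 2) ^ (-(2 : ℝ)) * ‖w‖ ^ (1 / 2 : ℝ)) * σ ^ (-(1 / 4 : ℝ)) := by
  unfold oseenMajorant
  simp only [oseen_exponent_fin_three, mul_assoc]
  rw [integral_const_mul, integral_add_norm_sq_rpow_neg_two_mul_sqrt hσ]
  ring

/-- The half-weighted majorant slice is integrable. [folklore] -/
theorem integrable_oseenMajorant_mul_sqrt_norm {σ : ℝ} (hσ : 0 < σ) :
    Integrable fun z : EuclideanSpace ℝ (Fin 3) => oseenMajorant (EuclideanSpace ℝ (Fin 3)) σ z * ‖z‖ ^ (1 / 2 : ℝ) := by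
  unfold oseenMajorant
  simp only [oseen_exponent_fin_three, mul_assoc]
  refine Integrable.const_mul ?_ _
  -- scale the unit profile
  set R : ℝ := Real.sqrt σ with hR
  have hR0 : 0 < R := Real.sqrt_pos.2 hσ
  have hR2 : R ^ 2 = σ := Real.sq_sqrt hσ.le
  have hcomp : (fun w : EuclideanSpace ℝ (Fin 3) => (σ + ‖R • w‖ ^ 2) ^ (-(2 : ℝ)) * ‖R • w‖ ^ (1 / 2 : ℝ)) =
      fun w => (σ ^ (-(2 : ℝ)) * R ^ (1 / 2 : ℝ)) * ((1 + ‖w‖ ^ 2) ^ (-(2 : ℝ)) * ‖w‖ ^ (1 / 2 : ℝ)) := by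
    funext w
    rw [norm_smul, Real.norm_of_nonneg hR0.le, mul_pow, hR2, show σ + σ * ‖w‖ ^ 2 = σ * (1 + ‖w‖ ^ 2) by ring,
      Real.mul_rpow hσ.le (by positivity), Real.mul_rpow hR0.le (norm_nonneg _)]
    ring
  have h := integrable_one_add_norm_sq_rpow_neg_two_mul_sqrt.const_mul (σ ^ (-(2 : ℝ)) * R ^ (1 / 2 : ℝ))
  rw [← hcomp] at h
  exact (integrable_comp_smul_iff volume
    (fun z : EuclideanSpace ℝ (Fin 3) => (σ + ‖z‖ ^ 2) ^ (-(2 : ℝ)) * ‖z‖ ^ (1 / 2 : ℝ)) hR0.ne').1 h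

end Summit.NavierStokesRegularity.NavierStokesRegularity.Cruxes.TypeIQuantSubcubicExp.QuietCollar

end
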